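import Summits.ABC.IUTFork.Repair.RHTameCellSlice
import HarnessLib

/-!
# R-H ROUND 2 → MIN-SLICE §(v) / round-3 inputs (C-i), (C-ii) for ROW 5 «tame-band-licence», the FULL-COLUMN law «μ₅(place) = 1 ⟺ the top
# cell ⟺ ord_v(q_v) ≤ 4·e(v|p)» (integer and genuine-datum currency), the SLACK PROFILE above the slice boundary, μ₅ per place

Seat abc-iut-rh-typ-5 (R-H PAIR n = 5 TYPER, gen 5; round-2 row-5 hand). PROOF-ONLY over this seat's `RH.TameBandLicence.Cell` (p458742),
`RHTameCellSlice` (p476650/p478702: antitone cell, boundary pair, `J ∈ {j₀, j₀+1}`, slice mass `n(n−1)(2n+5) = 6·Σ_{j≤n}(j²−1)`),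
abc-iut-rh-tst-5's sandwich `RHTameCellWindow` (p475488: `cell_of_succ_mul_le`), and for §4 abc-iut-C-cert's `Cor312Prov.exists_nat_qPilot_pilotDataOfK` /
`l_dvd_ramificationIdx'_of_over_VFbad` / `ramIdx_eq_ramIdx_finBelow_mul` BY NAME. No `def`, no new `Prop`, no instance, no notation. HONEST FRAMING: nothing here asserts abc proved or refuted; no side is taken on [IUTchIII] Cor. 3.12 or on any
author; H⋆ rows and `sigmaFive` are READING PREDICATES / hypotheses over OUR typed objects; typed ≠ proved; computed ≠ proved.

MIN-SLICE.md v1.4 §(v-1) publishes `μ(T) = Σ_v S(j₀(v))·h_v / (S(l⋆)·Σ_v h_v)`, `S(n) = n(n−1)(2n+5)/6`, and §(v-3) asks round 3 for (C-i) the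
l-window «μ(T) = 1» per datum and (C-ii) the SLACK PROFILE per cell above `j₀` («cliff / linear / quadratic»). For row 5 (cell `Cell e P j`:
`(j²−1)·P ≤ j·(e−1) + ρ_j`, `ρ_j = (j²P − 1) mod e`, `e = e_w`, `P = P_q(w) ∈ ℕ`, boundary pair `(J, J+1)`):

* §1 FULL COLUMN. `cell_top_iff_forall`: the place's column `{1..l⋆}` is entirely IN iff the TOP cell `Cell e P l⋆` holds (antitone). On a GENUINE
  tower (`e = b·f`, `f = e(w|v) = l·t`, `2l·P = f·Q`, so `2P = t·Q`; `b = e(v|p)`, `Q = ord_v(q_v)`, `l = 2l⋆+1`): **`Q ≤ 4b ⟹ Cell e P l⋆` at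
  EVERY `l`** (`cell_top_of_ord_le_four_mul`, through the band top), and **`Q ≥ 4b+1 ∧ l⋆ ≥ 6b+1 ⟹ ¬ Cell e P l⋆`** (`not_cell_top_of_four_mul_lt_ord`);
  between the two the remainder decides (`top_cell_edge_examples`: `Q = 5, b = 1` is IN at `l = 7`, OUT at `l = 11`). So in SLICE (S1) currency
  `k(v) = 2l·m_q/e_w = Q/b`: «μ₅(place) = 1 ⟺ k(v) ≤ 4» exactly below, and above from `l ≥ 12·e(v|p) + 3` on.
* §2 SLACK PROFILE above the boundary (C-ii), with the band defect `g(j) := (j²−1)P − j(e−1)` (`Cell ⟺ g(j) ≤ ρ_j`): `bandDefect_succ`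
  (`g(j+1) = g(j) + (2j+1)P − (e−1)`), `le_two_mul_add_one_mul_of_not_cell` (a failing label has `(2j+1)P ≥ e`), hence
  **`t + P(t−1)(t−2) ≤ g(J+t) ≤ (e−1) + P·t·(2J+t)`** (`bandDefect_lower_of_boundary`, `bandDefect_upper_of_cell`): row 5's class is QUADRATIC in the
  label distance `t` with leading coefficient exactly `P` and LINEAR ONSET (first miss can be `1`: `first_miss_margin_examples`); the licence margin
  `g − ρ_j` lies in `[g − (e−1), g]` (`licenceMargin_bracket`). The CREDIT the band grants at label `j`, `j(e−1) + ρ_j`, is LINEAR against the cell mass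
  `(j²−1)P`: **`(j−1)·credit_j ≤ (J+2)·mass_j`** (`pred_mul_credit_le_of_boundary`) — a partial-credit object riding the band recovers at most the
  fraction `(J+2)/(j−1)` of cell `j > J`, i.e. `O(J/l⋆)` of the off-slice mass `S(l⋆) − S(J)`.
* §3 μ₅ PER PLACE: `sliceMass_boundary_bracket` (`S(j₀) ≤ S(J) ≤ S(j₀) + ((j₀+1)²−1)` from `J ∈ {j₀, j₀+1}`), `full_sliceMass_le_iff_cell_top`
  (`S(l⋆) ≤ S(J) ⟺ Cell e P l⋆`: the place's share `S(min(J,l⋆))/S(l⋆)` is `1` iff the top cell holds).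
* §4 AT THE GENUINE DATUM `pilotDataOfK D K` (bad place `w ∣ p`, `v = w ∩ 𝓞_F`, `b = e(v|p) = ramIdx F v`, `Q = ord_v(q_v) = qParamOrd E v`,
  `P_w = P_q(w) ∈ ℕ`): `tower_bookkeeping_pilotDataOfK` (`e_w = b·(2l⋆+1)·t`, `2P_w = t·Q`, `t, b ≥ 1`, from `l ∣ e(w|v)`, `2l·P_w = e(w|v)·Q`,
  `e_w = e(v|p)·e(w|v)` — abc-iut-C-cert / w5-d054 BY NAME), **`cell_top_pilotDataOfK_of_qParamOrd_le`** (`Q ≤ 4b ⟹ Cell e_w P_w l⋆` at every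
  admissible `l`) and **`not_cell_top_pilotDataOfK_of_lt_qParamOrd`** (`Q ≥ 4b+1 ∧ l ≥ 12b+3 ⟹ ¬ Cell e_w P_w l⋆`): the gen-4 HANDOFF open item (a)
  «column full ⟺ top cell ⟺ ord_v(q_v) ≲ 4·e(v|p)», exact below and thresholded above. The window-bed sentence «μ₅(T) = 1 ⟺ every bad prime
  uniformly tame ∧ the top cell at each bad place» (abc-iut-rh2-T-1's `offTrivialMass` currency) is the companion PROOF-ONLY file
  `RHTameBandLicenceMuBed.lean` (same seat), which imports this one.
[cite: Mochizuki2012, IUTchI Def. 3.1 (b)(c) p. 61–62, Ex. 3.2 (iv) p. 71; IUTchIII Cor. 3.12 Step (xi-f) p. 184; IUTchIV Prop. 1.2 (i)(ii) p. 10]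
[cite: DupuyHilado2025, §3.3, §3.4, Thm. 3.10.1] [claim: Mochizuki2012, status: disputed]. Axioms: standard.
-/

namespace Summit.ABC.IUTFork.Repair.RH.TameBandLicence

/-! ## §1. The full column: top cell, and the «ord_v(q_v) ≤ 4·e(v|p)» law on a genuine tower -/

/-- **The column `{1,…,L}` is entirely IN iff the TOP cell holds** (`cell_anti`). [folklore] -/
theorem cell_top_iff_forall {e P L : ℤ} (he : 1 ≤ e) (hL : 1 ≤ L) :
    Cell e P L ↔ ∀ j : ℤ, 1 ≤ j → j ≤ L → Cell e P j :=
  ⟨fun h _ hj hjL => cell_anti he hj hjL h, fun h => h L hL le_rfl⟩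

/-- **Band top at the top label on a genuine tower, below the line `Q ≤ 4b`**: with `e = b·(2L+1)·t`, `2P = t·Q` (`L, t, b ≥ 1`) and
`Q ≤ 4b`, `(L²−1)·P ≤ L·(e−1)` (doubling: `(L²−1)tQ ≤ 4bL²t − 4bt ≤ 4bL²t + 2bLt − 2L`). [folklore] -/
theorem bandTop_top_of_ord_le_four_mul {L t b Q P e : ℤ} (hL : 1 ≤ L) (ht : 1 ≤ t) (hb : 1 ≤ b)
    (hP : 2 * P = t * Q) (he : e = b * ((2 * L + 1) * t)) (hQ : Q ≤ 4 * b) : (L ^ 2 - 1) * P ≤ L * (e - 1) := by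
  have hL2 : 0 ≤ L ^ 2 - 1 := by nlinarith
  have h1 : (L ^ 2 - 1) * (t * Q) ≤ (L ^ 2 - 1) * (t * (4 * b)) :=
    mul_le_mul_of_nonneg_left (mul_le_mul_of_nonneg_left hQ (by omega)) hL2
  have h2 : 2 * ((L ^ 2 - 1) * P) = (L ^ 2 - 1) * (t * Q) := by rw [← hP]; ring
  have h3 : 2 * (L * (e - 1)) = 4 * b * L ^ 2 * t + 2 * b * L * t - 2 * L := by rw [he]; ring
  have h4 : (L ^ 2 - 1) * (t * (4 * b)) = 4 * b * L ^ 2 * t - 4 * b * t := by ring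
  have hbt : 1 ≤ b * t := by nlinarith
  have h5 : L * 1 ≤ L * (b * t) := mul_le_mul_of_nonneg_left hbt (by omega)
  have h6 : L * (b * t) = b * L * t := by ring
  have h7 : 0 ≤ b * t := by omega
  linarith

/-- **`Q ≤ 4b ⟹ the TOP cell holds, at every `l`** (genuine tower `e = b(2L+1)t`, `2P = tQ`). In SLICE (S1) currency `k(v) = Q/b ≤ 4`. [folklore] -/
theorem cell_top_of_ord_le_four_mul {L t b Q P e : ℤ} (hL : 1 ≤ L) (ht : 1 ≤ t) (hb : 1 ≤ b)
    (hP : 2 * P = t * Q) (he : e = b * ((2 * L + 1) * t)) (hQ : Q ≤ 4 * b) : Cell e P L := by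
  refine cell_of_bandTop ?_ (bandTop_top_of_ord_le_four_mul hL ht hb hP he hQ)
  have : 3 ≤ (2 * L + 1) * t := by nlinarith
  nlinarith

/-- **`Q ≥ 4b + 1` and `L ≥ 6b + 1` ⟹ the TOP cell FAILS** (genuine tower `e = b(2L+1)t`, `2P = tQ`, `t, b ≥ 1`): the cell would give
`(L−1)P ≤ e−1` (remainder `≤ e−1`, divide by `L+1`), i.e. `(L−1)tQ ≤ 4bLt + 2bt − 2`, against `(L−1)t(4b+1) = 4bLt + (L−4b−1)t`. [folklore] -/
theorem not_cell_top_of_four_mul_lt_ord {L t b Q P e : ℤ} (ht : 1 ≤ t) (hb : 1 ≤ b) (hP : 2 * P = t * Q)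
    (he : e = b * ((2 * L + 1) * t)) (hQ : 4 * b + 1 ≤ Q) (hL : 6 * b + 1 ≤ L) : ¬ Cell e P L := by
  intro hc
  rw [cell_iff] at hc
  have he0 : 0 < e := by
    have : 3 ≤ (2 * L + 1) * t := by nlinarith
    nlinarith
  have hρ : (L ^ 2 * P - 1) % e < e := Int.emod_lt_of_pos _ he0
  -- `(L²−1)P ≤ (L+1)(e−1)`, then divide by `L+1 > 0`
  have h1 : (L + 1) * ((L - 1) * P) ≤ (L + 1) * (e - 1) := by
    have : (L + 1) * ((L - 1) * P) = (L ^ 2 - 1) * P := by ring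
    linarith
  have h2 : (L - 1) * P ≤ e - 1 := le_of_mul_le_mul_left h1 (by omega)
  have h3 : (L - 1) * (t * Q) ≤ 2 * b * ((2 * L + 1) * t) - 2 := by
    have : 2 * ((L - 1) * P) = (L - 1) * (t * Q) := by rw [← hP]; ring
    rw [he] at h2
    linarith
  have h4 : (L - 1) * (t * (4 * b + 1)) ≤ (L - 1) * (t * Q) :=
    mul_le_mul_of_nonneg_left (mul_le_mul_of_nonneg_left hQ (by omega)) (by omega)
  have e1 : (L - 1) * (t * (4 * b + 1)) = 4 * b * L * t + L * t - 4 * b * t - t := by ring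
  have e2 : 2 * b * ((2 * L + 1) * t) - 2 = 4 * b * L * t + 2 * b * t - 2 := by ring
  have h5 : 0 ≤ t * (L - 6 * b - 1) := mul_nonneg (by omega) (by omega)
  have e3 : t * (L - 6 * b - 1) = L * t - 6 * b * t - t := by ring
  linarith

/-- **Edge examples (the remainder decides between `Q = 4b` and the threshold `L = 6b+1`)**, `b = 1`, `Q = 5`, `t = 2` (`e = 2l`, `P = 5`):
IN at `l = 7` (`Cell 14 5 3`), OUT at `l = 11` (`¬ Cell 22 5 5`) and at `l = 13` (`¬ Cell 26 5 6`); `Q = 6`, `t = 1` (`e = l`, `P = 3`): IN at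
`l = 5` (`Cell 5 3 2`, HEX k = 3), OUT at `l = 7` (`¬ Cell 7 3 3`). [folklore] -/
theorem top_cell_edge_examples :
    Cell 14 5 3 ∧ ¬ Cell 22 5 5 ∧ ¬ Cell 26 5 6 ∧ Cell 5 3 2 ∧ ¬ Cell 7 3 3 := by
  simp only [Cell]
  decide

/-! ## §2. The slack profile above the boundary (round-3 input (C-ii) for row 5) -/

/-- **Band-defect recursion**: `g(j+1) = g(j) + ((2j+1)P − (e−1))` for `g(j) := (j²−1)P − j(e−1)`. [folklore] -/
theorem bandDefect_succ (e P j : ℤ) :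
    ((j + 1) ^ 2 - 1) * P - (j + 1) * (e - 1) = ((j ^ 2 - 1) * P - j * (e - 1)) + ((2 * j + 1) * P - (e - 1)) := by
  ring

/-- **The cell in defect form**: `¬ Cell e P j ⟺ 0 < g(j) − ρ_j` (the licence margin is positive). [folklore] -/
theorem not_cell_iff_margin_pos (e P j : ℤ) :
    ¬ Cell e P j ↔ 0 < (j ^ 2 - 1) * P - (j * (e - 1) + (j ^ 2 * P - 1) % e) := by
  rw [cell_iff, not_le, sub_pos]

/-- **The licence margin lies within `e−1` below the band defect**: `g(j) − (e−1) ≤ g(j) − ρ_j ≤ g(j)` (`ρ_j ∈ [0, e−1]`, `e ≥ 1`). [folklore] -/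
theorem licenceMargin_bracket {e : ℤ} (he : 1 ≤ e) (P j : ℤ) :
    (j ^ 2 - 1) * P - j * (e - 1) - (e - 1) ≤ (j ^ 2 - 1) * P - (j * (e - 1) + (j ^ 2 * P - 1) % e) ∧
      (j ^ 2 - 1) * P - (j * (e - 1) + (j ^ 2 * P - 1) % e) ≤ (j ^ 2 - 1) * P - j * (e - 1) := by
  have h0 : 0 ≤ (j ^ 2 * P - 1) % e := Int.emod_nonneg _ (by omega)
  have h1 : (j ^ 2 * P - 1) % e < e := Int.emod_lt_of_pos _ (by omega)
  constructor <;> linarith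

/-- **A failing label has `(2j+1)·P ≥ e`** (`e, j ≥ 1`; the key step of `not_cell_succ_of_not_cell`, isolated): otherwise
`(j²−1)P > j(e−1) ≥ j(2j+1)P`, absurd for the then positive `P`. [folklore] -/
theorem le_two_mul_add_one_mul_of_not_cell {e P j : ℤ} (he : 1 ≤ e) (hj : 1 ≤ j) (h : ¬ Cell e P j) :
    e ≤ (2 * j + 1) * P := by
  rw [cell_iff] at h
  push Not at h
  have h0 : 0 ≤ (j ^ 2 * P - 1) % e := Int.emod_nonneg _ (by omega)
  have hP : 1 ≤ P := by
    by_contra hP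
    push Not at hP
    have h1 : (j ^ 2 - 1) * P ≤ 0 := mul_nonpos_of_nonneg_of_nonpos (by nlinarith) (by omega)
    nlinarith
  by_contra h3
  push Not at h3
  have h4 : j * ((2 * j + 1) * P) ≤ j * (e - 1) := mul_le_mul_of_nonneg_left (by omega) (by omega)
  have h5 : 0 < (j ^ 2 + j + 1) * P := mul_pos (by nlinarith) (by omega)
  nlinarith

/-- **At a failing label the band defect is `≥ 1`** (`g(j) > ρ_j ≥ 0`). [folklore] -/
theorem one_le_bandDefect_of_not_cell {e P j : ℤ} (he : 1 ≤ e) (h : ¬ Cell e P j) :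
    1 ≤ (j ^ 2 - 1) * P - j * (e - 1) := by
  rw [cell_iff] at h
  push Not at h
  have h0 : 0 ≤ (j ^ 2 * P - 1) % e := Int.emod_nonneg _ (by omega)
  linarith

/-- **Quadratic lower profile from the first failing label `j₁`**: `g(j₁ + s) ≥ 1 + s + P·s·(s−1)` for every `s ∈ ℕ` (each further step adds
`(2j+1)P − (e−1) ≥ 2(j−j₁)P + 1`). [folklore] -/
theorem bandDefect_lower {e P j₁ : ℤ} (he : 1 ≤ e) (hj₁ : 1 ≤ j₁) (h : ¬ Cell e P j₁) (s : ℕ) :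
    1 + (s : ℤ) + P * s * ((s : ℤ) - 1) ≤ ((j₁ + s) ^ 2 - 1) * P - (j₁ + s) * (e - 1) := by
  have hkey := le_two_mul_add_one_mul_of_not_cell he hj₁ h
  induction s with
  | zero =>
    simp only [Nat.cast_zero, add_zero, mul_zero, zero_mul]
    exact one_le_bandDefect_of_not_cell he h
  | succ s ih =>
    push_cast
    have hrec := bandDefect_succ e P (j₁ + s)
    have e0 : j₁ + ((s : ℤ) + 1) = j₁ + s + 1 := by ring
    rw [e0]
    have e1 : P * ((s : ℤ) + 1) * ((s : ℤ) + 1 - 1) = P * s * ((s : ℤ) - 1) + 2 * s * P := by ring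
    have e2 : (2 * (j₁ + (s : ℤ)) + 1) * P - (e - 1) = (2 * j₁ + 1) * P + 2 * s * P - e + 1 := by ring
    linarith

/-- **(C-ii) LOWER PROFILE at a boundary pair**: if label `J+1` fails (`J ≥ 0`), then for every `t ≥ 1`,
`t + P·(t−1)·(t−2) ≤ g(J+t)` — QUADRATIC in the label distance with leading coefficient `P`, onset `≥ 1`. [folklore] -/
theorem bandDefect_lower_of_boundary {e P J t : ℤ} (he : 1 ≤ e) (hJ : 0 ≤ J) (hoff : ¬ Cell e P (J + 1)) (ht : 1 ≤ t) :
    t + P * (t - 1) * (t - 2) ≤ ((J + t) ^ 2 - 1) * P - (J + t) * (e - 1) := by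
  obtain ⟨s, rfl⟩ : ∃ s : ℕ, t = (s : ℤ) + 1 := ⟨(t - 1).toNat, by omega⟩
  have h := bandDefect_lower he (by omega) hoff s
  have e1 : J + ((s : ℤ) + 1) = J + 1 + s := by ring
  rw [e1]
  have e2 : ((s : ℤ) + 1) + P * ((s : ℤ) + 1 - 1) * ((s : ℤ) + 1 - 2) = 1 + s + P * s * ((s : ℤ) - 1) := by ring
  linarith

/-- **(C-ii) UPPER PROFILE from an IN label**: if `Cell e P J` then for every `t ≥ 0`, `g(J+t) ≤ (e−1) + P·t·(2J+t)` (`g(J) ≤ ρ_J ≤ e−1` and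
`g(J+t) − g(J) = P·t·(2J+t) − t(e−1)`) — the same quadratic class from above. [folklore] -/
theorem bandDefect_upper_of_cell {e P J t : ℤ} (he : 1 ≤ e) (hin : Cell e P J) (ht : 0 ≤ t) :
    ((J + t) ^ 2 - 1) * P - (J + t) * (e - 1) ≤ (e - 1) + P * t * (2 * J + t) := by
  rw [cell_iff] at hin
  have hρ : (J ^ 2 * P - 1) % e < e := Int.emod_lt_of_pos _ (by omega)
  have e1 : ((J + t) ^ 2 - 1) * P - (J + t) * (e - 1) =
      ((J ^ 2 - 1) * P - J * (e - 1)) + (P * t * (2 * J + t) - t * (e - 1)) := by ring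
  have h2 : 0 ≤ t * (e - 1) := mul_nonneg ht (by omega)
  linarith

/-- **First-miss examples**: the margin at the first failing label can be as small as `1` (`(e,P) = (22,5)`, top label `5`: margin
`120 − (105 + 14) = 1`) or larger (`(e,P) = (5,4)`, label `2` = HEX k = 4 at `l = 5`: `12 − (8 + 0) = 4`). [folklore] -/
theorem first_miss_margin_examples :
    ((5 : ℤ) ^ 2 - 1) * 5 - (5 * (22 - 1) + (5 ^ 2 * 5 - 1) % 22) = 1 ∧
      ((2 : ℤ) ^ 2 - 1) * 4 - (2 * (5 - 1) + (2 ^ 2 * 4 - 1) % 5) = 4 := by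
  decide

/-- **(C-ii) PARTIAL-CREDIT CEILING: the band's credit is LINEAR, the cell mass QUADRATIC.** At a boundary pair `(J, J+1)` (`e, P, J ≥ 1`) and
any label `j ≥ 1`: `(j−1)·(j(e−1) + ρ_j) ≤ (J+2)·((j²−1)·P)` — the licensed amount at cell `j` is at most the fraction `(J+2)/(j−1)` of its
`(j²−1)·P` mass (`ρ_j ≤ e−1 < (J+2)P` by the bracket `J ≥ ⌊(e−1)/P⌋ − 1`). Summed over `j ∈ (J, l⋆]` a band-riding partial-credit object recovers
`O(J/l⋆)` of the off-slice mass. [folklore] -/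
theorem pred_mul_credit_le_of_boundary {e P J j : ℤ} (he : 1 ≤ e) (hP : 1 ≤ P) (hJ : 1 ≤ J) (hin : Cell e P J)
    (hoff : ¬ Cell e P (J + 1)) (hj : 1 ≤ j) :
    (j - 1) * (j * (e - 1) + (j ^ 2 * P - 1) % e) ≤ (J + 2) * ((j ^ 2 - 1) * P) := by
  have hb := (boundary_bracket he hP hJ hin hoff).1
  have h0 : e - 1 < P * ((e - 1) / P) + P := Int.lt_mul_ediv_self_add (by omega)
  have h1 : e - 1 ≤ (J + 2) * P := by
    have h1' : P * ((e - 1) / P + 1) ≤ P * (J + 2) := mul_le_mul_of_nonneg_left (by omega) (by omega)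
    have h1'' : P * ((e - 1) / P + 1) = P * ((e - 1) / P) + P := by ring
    linarith [mul_comm P (J + 2)]
  have hρ : (j ^ 2 * P - 1) % e < e := Int.emod_lt_of_pos _ (by omega)
  have h2 : j * (e - 1) + (j ^ 2 * P - 1) % e ≤ (j + 1) * (e - 1) := by linarith
  have h3 : (j - 1) * (j * (e - 1) + (j ^ 2 * P - 1) % e) ≤ (j - 1) * ((j + 1) * (e - 1)) :=
    mul_le_mul_of_nonneg_left h2 (by omega)
  have h4 : (j - 1) * ((j + 1) * (e - 1)) = (j ^ 2 - 1) * (e - 1) := by ring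
  have h5 : (j ^ 2 - 1) * (e - 1) ≤ (j ^ 2 - 1) * ((J + 2) * P) := mul_le_mul_of_nonneg_left h1 (by nlinarith)
  have h6 : (j ^ 2 - 1) * ((J + 2) * P) = (J + 2) * ((j ^ 2 - 1) * P) := by ring
  linarith

/-! ## §3. μ₅ per place: the slice mass between `S(j₀)` and `S(j₀+1)`, and `= S(l⋆)` iff the top cell -/

/-- **`S(j₀) ≤ S(J) ≤ S(j₀) + ((j₀+1)² − 1)`** (times `6`): the place's on-slice `j²−1` mass for the exact boundary `J ∈ {j₀, j₀+1}` against the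
lead's closed-form label `j₀` (last band-top label). [folklore] -/
theorem sliceMass_boundary_bracket {e P J j0 : ℤ} (he : 1 ≤ e) (hJ : 1 ≤ J) (hin : Cell e P J) (hoff : ¬ Cell e P (J + 1))
    (hj0 : 1 ≤ j0) (hbt : (j0 ^ 2 - 1) * P ≤ j0 * (e - 1)) (hbt' : (j0 + 1) * (e - 1) < ((j0 + 1) ^ 2 - 1) * P) :
    j0 * (j0 - 1) * (2 * j0 + 5) ≤ J * (J - 1) * (2 * J + 5) ∧
      J * (J - 1) * (2 * J + 5) ≤ j0 * (j0 - 1) * (2 * j0 + 5) + 6 * ((j0 + 1) ^ 2 - 1) := by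
  rcases boundary_eq_or_eq_succ_of_bandTop he hJ hin hoff hj0 hbt hbt' with rfl | rfl
  · refine ⟨le_rfl, ?_⟩
    have : 0 ≤ (J + 1) ^ 2 - 1 := by nlinarith
    linarith
  · refine ⟨sliceMass_mono (by omega) (by omega), ?_⟩
    have := sliceMass_succ_sub j0
    linarith

/-- **μ₅(place) = 1 ⟺ the top cell**: for the boundary `J` and the top label `L ≥ 1`, `S(L) ≤ S(J)` (the column mass is the full mass) iff
`Cell e P L` (iff `L ≤ J`; one missing label already costs the quantum `6(L²−1) > 0`, `sliceMass_add_quantum_le`). [folklore] -/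
theorem full_sliceMass_le_iff_cell_top {e P J L : ℤ} (he : 1 ≤ e) (hJ : 1 ≤ J) (hL : 1 ≤ L) (hin : Cell e P J)
    (hoff : ¬ Cell e P (J + 1)) : L * (L - 1) * (2 * L + 5) ≤ J * (J - 1) * (2 * J + 5) ↔ Cell e P L := by
  rw [cell_iff_le_of_boundary he hJ hin hoff hL]
  constructor
  · intro h
    by_contra hlt
    push Not at hlt
    have hq := sliceMass_add_quantum_le (show (0 : ℤ) ≤ J by omega) (show J ≤ L - 1 by omega)
    have : 0 < L ^ 2 - 1 := by nlinarith
    linarith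
  · exact fun h => sliceMass_mono (by omega) h

end Summit.ABC.IUTFork.Repair.RH.TameBandLicence

noncomputable section
open Set Metric Function NumberField IsDedekindDomain
open scoped Pointwise

namespace Summit.ABC.IUTFork.Repair.RH.TameBandLicenceSigma

open Literature.AnabelianGeometry.AbsoluteAnabelian Literature.IUT.LogThetaLattice Literature.IUT.LogVolume
  Literature.IUT.HodgeTheaters Literature.NumberTheory.NumberFields Literature.NumberTheory.GaloisRepresentations.Ultrametric
open Summit.ABC.IUTFork.Thm311 Summit.ABC.IUTFork.Thm311.Real Summit.ABC.IUTFork.Cor312 Summit.ABC.IUTFork.Cor312.Setting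
  Summit.ABC.IUTFork.Cor312Vol Summit.ABC.IUTFork.Cor312Prov Summit.ABC.IUTFork.Repair.RH.TameBandLicence
  Summit.ABC.IUTFork.Repair.RH.SigmaLicence

variable {F K Fbar : Type} [Field F] [NumberField F] [Field K] [NumberField K] [Algebra F K] [Field Fbar]
  [Algebra F Fbar] [Algebra K Fbar] {E : WeierstrassCurve F} [E.IsElliptic] {l : ℕ} {Pb : BadPlacePredicates K}
  (D : InitialThetaData F K Fbar E l Pb)

/-! ## §4. At the genuine datum `pilotDataOfK D K`: the `ord_v(q_v) ≤ 4·e(v|p)` law in the datum's own currency -/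

/-- **Tower bookkeeping at a bad fibre point of the genuine datum**: with `v = w ∩ 𝓞_F`, `b = e(v|p)` (`ramIdx F v`), `Q = ord_v(q_v)`
(`qParamOrd E v`) and the integral q-degree `P = P_q(w)`: `e_w = b·(2l⋆+1)·t` and `2P = t·Q` for some `t ≥ 1` (`e(w|v) = l·t` by
`l ∣ e(w|v)`, `2l·P = e(w|v)·Q`, `e_w = e(v|p)·e(w|v)`), and `b ≥ 1`. [cite: Mochizuki2012, IUTchI Def. 3.1 (c) p. 61–62, Ex. 3.2 (iv) p. 71]
[cite: DupuyHilado2025, §3.3] [cite: NeukirchANT1999, Ch. II Prop. (6.8)] -/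
theorem tower_bookkeeping_pilotDataOfK (pp : Nat.Primes) (w : (thetaIndex (pilotDataOfK D K)).Fibre (.inr pp))
    (hw : haveI : Fact (pp : ℕ).Prime := ⟨pp.2⟩; placeOf (pilotDataOfK D K) pp.1 w ∈ (pilotDataOfK D K).S) {P : ℕ}
    (hP : haveI : Fact (pp : ℕ).Prime := ⟨pp.2⟩; (pilotDataOfK D K).qPilot (placeOf (pilotDataOfK D K) pp.1 w) = P) :
    haveI : Fact (pp : ℕ).Prime := ⟨pp.2⟩
    ∃ t : ℕ, 1 ≤ t ∧
      (((placeOf (pilotDataOfK D K) pp.1 w).asIdeal.ramificationIdx ℤ : ℕ) : ℤ) =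
          (ramIdx F (finBelow F K (placeOf (pilotDataOfK D K) pp.1 w)) : ℤ) * ((2 * ((pilotDataOfK D K).lstar : ℤ) + 1) * t) ∧
        2 * (P : ℤ) = (t : ℤ) * (qParamOrd E (finBelow F K (placeOf (pilotDataOfK D K) pp.1 w)) : ℤ) ∧
          1 ≤ (ramIdx F (finBelow F K (placeOf (pilotDataOfK D K) pp.1 w)) : ℤ) := by
  haveI : Fact (pp : ℕ).Prime := ⟨pp.2⟩
  set v := placeOf (pilotDataOfK D K) pp.1 w with hv
  obtain ⟨P', hP', -, h2l⟩ := exists_nat_qPilot_pilotDataOfK D hw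
  have hPP : P = P' := by
    have h1 : ((P : ℕ) : ℝ) = P' := hP.symm.trans hP'
    exact_mod_cast h1
  subst hPP
  obtain ⟨t, ht⟩ := l_dvd_ramificationIdx'_of_over_VFbad D v ((mem_pilotDataOfK_S_iff D K v).mp hw)
  have hf0 : (finBelow F K v).asIdeal.ramificationIdx' v.asIdeal ≠ 0 := ramificationIdx'_finBelow_ne_zero (F := F) K v
  have ht1 : 1 ≤ t := by
    rcases Nat.eq_zero_or_pos t with h | h
    · rw [h, mul_zero] at ht
      exact absurd ht hf0
    · exact h
  have hl : l = 2 * (pilotDataOfK D K).lstar + 1 := by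
    have h1 := (pilotDataOfK D K).l_eq
    rwa [pilotDataOfK_l] at h1
  have hram : v.asIdeal.ramificationIdx ℤ = ramIdx F (finBelow F K v) * (finBelow F K v).asIdeal.ramificationIdx' v.asIdeal := by
    rw [← ramIdx_eq K v]
    exact ramIdx_eq_ramIdx_finBelow_mul (F := F) v
  have hb : 1 ≤ ramIdx F (finBelow F K v) := Nat.one_le_iff_ne_zero.mpr (ramIdx_ne_zero F (finBelow F K v))
  refine ⟨t, ht1, ?_, ?_, by exact_mod_cast hb⟩
  · rw [hram, ht]
    push_cast
    have hl' : ((l : ℕ) : ℤ) = 2 * ((pilotDataOfK D K).lstar : ℤ) + 1 := by exact_mod_cast hl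
    rw [hl']
  · have h0 := h2l
    rw [ht] at h0
    have h1 : (l : ℤ) * (2 * (P : ℤ)) = (l : ℤ) * ((t : ℤ) * (qParamOrd E (finBelow F K v) : ℤ)) := by
      have h2 := congrArg (fun m : ℕ => (m : ℤ)) h0
      push_cast at h2
      linarith
    have hl0 : (l : ℤ) ≠ 0 := by
      have := D.five_le_l
      omega
    exact mul_left_cancel₀ hl0 h1

/-- **ROW 5's FULL-COLUMN LAW at the genuine bed, sufficient side: `ord_v(q_v) ≤ 4·e(v|p)` ⟹ the TOP cell `Cell e_w P_w l⋆` holds** at the bad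
place `w` (every admissible `l`; §1 `cell_top_of_ord_le_four_mul` with §4a's bookkeeping). [cite: Mochizuki2012, IUTchI Ex. 3.2 (iv) p. 71;
IUTchIV Prop. 1.2 (i)(ii) p. 10] [cite: DupuyHilado2025, §3.3, §3.4] [claim: Mochizuki2012, status: disputed] -/
theorem cell_top_pilotDataOfK_of_qParamOrd_le (pp : Nat.Primes) (w : (thetaIndex (pilotDataOfK D K)).Fibre (.inr pp))
    (hw : haveI : Fact (pp : ℕ).Prime := ⟨pp.2⟩; placeOf (pilotDataOfK D K) pp.1 w ∈ (pilotDataOfK D K).S) {P : ℕ}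
    (hP : haveI : Fact (pp : ℕ).Prime := ⟨pp.2⟩; (pilotDataOfK D K).qPilot (placeOf (pilotDataOfK D K) pp.1 w) = P)
    (hQ : haveI : Fact (pp : ℕ).Prime := ⟨pp.2⟩
      qParamOrd E (finBelow F K (placeOf (pilotDataOfK D K) pp.1 w)) ≤ 4 * ramIdx F (finBelow F K (placeOf (pilotDataOfK D K) pp.1 w))) :
    haveI : Fact (pp : ℕ).Prime := ⟨pp.2⟩
    Cell (((placeOf (pilotDataOfK D K) pp.1 w).asIdeal.ramificationIdx ℤ : ℕ) : ℤ) (P : ℤ) ((pilotDataOfK D K).lstar : ℤ) := by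
  haveI : Fact (pp : ℕ).Prime := ⟨pp.2⟩
  obtain ⟨t, ht1, he, h2P, hb⟩ := tower_bookkeeping_pilotDataOfK D pp w hw hP
  have hL : (1 : ℤ) ≤ ((pilotDataOfK D K).lstar : ℤ) := by
    have := (pilotDataOfK D K).two_le_lstar
    omega
  exact cell_top_of_ord_le_four_mul hL (by exact_mod_cast ht1) hb h2P he (by exact_mod_cast hQ)

/-- **… and the necessary side: `ord_v(q_v) ≥ 4·e(v|p) + 1` and `l ≥ 12·e(v|p) + 3` ⟹ the TOP cell FAILS** at `w` (§1
`not_cell_top_of_four_mul_lt_ord`). [cite: Mochizuki2012, IUTchI Ex. 3.2 (iv) p. 71; IUTchIV Prop. 1.2 (i)(ii) p. 10] [cite: DupuyHilado2025, §3.3, §3.4]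
[claim: Mochizuki2012, status: disputed] -/
theorem not_cell_top_pilotDataOfK_of_lt_qParamOrd (pp : Nat.Primes) (w : (thetaIndex (pilotDataOfK D K)).Fibre (.inr pp))
    (hw : haveI : Fact (pp : ℕ).Prime := ⟨pp.2⟩; placeOf (pilotDataOfK D K) pp.1 w ∈ (pilotDataOfK D K).S) {P : ℕ}
    (hP : haveI : Fact (pp : ℕ).Prime := ⟨pp.2⟩; (pilotDataOfK D K).qPilot (placeOf (pilotDataOfK D K) pp.1 w) = P)
    (hQ : haveI : Fact (pp : ℕ).Prime := ⟨pp.2⟩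
      4 * ramIdx F (finBelow F K (placeOf (pilotDataOfK D K) pp.1 w)) + 1 ≤ qParamOrd E (finBelow F K (placeOf (pilotDataOfK D K) pp.1 w)))
    (hl : haveI : Fact (pp : ℕ).Prime := ⟨pp.2⟩; 12 * ramIdx F (finBelow F K (placeOf (pilotDataOfK D K) pp.1 w)) + 3 ≤ l) :
    haveI : Fact (pp : ℕ).Prime := ⟨pp.2⟩
    ¬ Cell (((placeOf (pilotDataOfK D K) pp.1 w).asIdeal.ramificationIdx ℤ : ℕ) : ℤ) (P : ℤ) ((pilotDataOfK D K).lstar : ℤ) := by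
  haveI : Fact (pp : ℕ).Prime := ⟨pp.2⟩
  obtain ⟨t, ht1, he, h2P, hb⟩ := tower_bookkeeping_pilotDataOfK D pp w hw hP
  have hL : 6 * (ramIdx F (finBelow F K (placeOf (pilotDataOfK D K) pp.1 w)) : ℤ) + 1 ≤ ((pilotDataOfK D K).lstar : ℤ) := by
    have h1 := (pilotDataOfK D K).l_eq
    rw [pilotDataOfK_l] at h1
    omega
  exact not_cell_top_of_four_mul_lt_ord (by exact_mod_cast ht1) hb h2P he (by exact_mod_cast hQ) hL

end Summit.ABC.IUTFork.Repair.RH.TameBandLicenceSigma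

end
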